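import Summits.Ventures.LatticeQCDFlow.Scaling.HubChainEigenbasis

/-!
HONEST FRAMING: exact (Metropolis-corrected) sampling algorithms for lattice gauge theory; figures
of merit are autocorrelation/cost numbers at stated couplings and volumes; no continuum-physics
claim.

# HubChainTransitionLaw — THE SWAP PHASE SOLVED EXACTLY, II: THE CLOSED `n`-STEP LAW OF THE HUB CHAIN, `Pⁿ(i,j) = ρ_j·(1/R + Σ_k β_kⁿ f_k(i)f_k(j)/(ρ_kR_kR_{k+1}))`, AND ITS
# SMITH–TIERNEY FORM `Pⁿ(i,j) = ρ_j·T_n(deeper of i,j) + β_iⁿ·δ_{ij}` WITH `T_n(j) = (1−β_jⁿ)/R + Σ_{k>j}(1/R_k − 1/R_{k+1})(β_kⁿ − β_jⁿ)`: FROM EVERY START SHALLOWER THAN THE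
# TARGET THE LAW AT THE TARGET IS THE SAME, AND BELOW THE START THE LAW IS `∝ ρ` (lean-2 GEN-39, ours)

Venture-side (OURS).  Cell `lqcd-flow` (pub-lqcd), unit `pub-lqcd-lean-2-g39`, 2026-08-30.  Chapter Y (the swap phase solved exactly), file 2.  Setting and hypothesis-equations of
file 1 (`HubChainEigenbasis`): ranks `0,…,m−1` by non-decreasing depth `ρ > 0`, `R_k = Σ_{i<k}ρ_i`, `P(i,j) = c·min{1,ρ_j/ρ_i}` off the diagonal, unit row sums on `range m`,
`f_k`, `β_k` as there; the `n`-step kernel `Pⁿ` is supplied by its recursion (`P⁰ = δ`, `Pⁿ⁺¹ = PⁿP`).  From the eigen-equation, reversibility and completeness of file 1: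

* `hubChain_rho_stationary` (`Σ_l ρ_lP(l,j) = ρ_j`), `hubChain_eigen_left` (`Σ_l ρ_lf_k(l)P(l,j) = β_kρ_jf_k(j)`);
* **`hubChain_pow_eq`**: `Pⁿ(i,j) = ρ_j·(1/R_m + Σ_{k<m} β_kⁿf_k(i)f_k(j)/(ρ_kR_kR_{k+1}))`;
* **`hubChain_pow_offdiag`** ∕ **`hubChain_pow_diag`** (the Smith–Tierney form): for `i ≠ j`, `Pⁿ(i,j) = ρ_j·T_n(max(i,j))`, and `Pⁿ(j,j) = ρ_j·T_n(j) + β_jⁿ`, where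
  `T_n(j) = (1−β_jⁿ)/R_m + Σ_{j<k<m}(1/R_k − 1/R_{k+1})(β_kⁿ − β_jⁿ)` — a function of the DEEPER of the two ranks only;
* corollaries: `hubChain_pow_start_indep` (`Pⁿ(i,j) = Pⁿ(i',j)` for `i, i' < j`: the law at a deeper target forgets the shallower start), `hubChain_pow_below_start`
  (`ρ_{j'}Pⁿ(i,j) = ρ_jPⁿ(i,j')` for `j, j' < i`: below the start the law is `∝ ρ`), `hubChain_T_nonneg` (`T_n ≥ 0`).

Printed counterparts NAMED ONLY: Liu 1996 (finite IMH eigen-analysis), Smith–Tierney 1996 (exact transition probabilities); lean-1's `Exactness/IMHSmithTierney` is the general-space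
version (`(Kⁿ⁺¹g)(x) = ∫ T_{n+1}(b(x) ∨ b(z))g(z)w(z)dμ + λ(b(x))ⁿ⁺¹g(x)`).  Here: the finite labelled chain with self-exclusion (so `β` may be negative at shallow ranks), as
hypothesis-equations, no definitions.

Reading (no numerics implied): exact laws of the swap phase; the resolvent (chapter W's end-hub laws) is file 3.  Literature grade (cell rule): OWN, elementary; nothing cited as a
fact; no new bib keys.
-/

open Finset

namespace Summit.Ventures.LatticeQCDFlow.Scaling

section HubChainPow
variable {m : ℕ} {ρ R β : ℕ → ℝ} {c : ℝ} {P f : ℕ → ℕ → ℝ} {Pn : ℕ → ℕ → ℕ → ℝ} {T : ℕ → ℕ → ℝ}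

/-- **Stationarity of `ρ`:** `Σ_{l<m} ρ_lP(l,j) = ρ_j` for `j < m`. [ours] -/
theorem hubChain_rho_stationary (hρ : ∀ i, 0 < ρ i) (hPoff : ∀ i j, i ≠ j → P i j = c * min 1 (ρ j / ρ i))
    (hPdiag : ∀ i, P i i = 1 - ∑ j ∈ (range m).erase i, P i j) {j : ℕ} (hj : j < m) : ∑ l ∈ range m, ρ l * P l j = ρ j := by
  calc ∑ l ∈ range m, ρ l * P l j = ∑ l ∈ range m, ρ j * P j l := sum_congr rfl fun l _ => hubChain_reversible hρ hPoff l j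
    _ = ρ j := by rw [← mul_sum, hubChain_rowsum hPdiag hj, mul_one]

/-- **Left eigen-equation:** `Σ_{l<m} ρ_lf_k(l)P(l,j) = β_k·ρ_j·f_k(j)`. [ours] -/
theorem hubChain_eigen_left (hρ : ∀ i, 0 < ρ i) (hmono : Monotone ρ) (hR : ∀ k, R k = ∑ i ∈ range k, ρ i)
    (hPoff : ∀ i j, i ≠ j → P i j = c * min 1 (ρ j / ρ i)) (hPdiag : ∀ i, P i i = 1 - ∑ j ∈ (range m).erase i, P i j)
    (hf : ∀ k i, f k i = if i < k then ρ k else if i = k then -R k else 0)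
    (hβ : ∀ k, β k = 1 - c * (((m - k : ℕ) : ℝ) + R k / ρ k)) {k j : ℕ} (hk : k < m) (hj : j < m) :
    ∑ l ∈ range m, ρ l * f k l * P l j = β k * ρ j * f k j := by
  calc ∑ l ∈ range m, ρ l * f k l * P l j = ∑ l ∈ range m, ρ j * (P j l * f k l) := sum_congr rfl fun l _ => by
          rw [mul_right_comm, hubChain_reversible hρ hPoff l j]; ring
    _ = β k * ρ j * f k j := by rw [← mul_sum, hubChain_eigen hρ hmono hR hPoff hPdiag hf hβ hk hj]; ring

/-- **THE CLOSED `n`-STEP LAW:** `Pⁿ(i,j) = ρ_j·(1/R_m + Σ_{k<m} β_kⁿf_k(i)f_k(j)/(ρ_kR_kR_{k+1}))` for `i, j < m`. [ours] -/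
theorem hubChain_pow_eq (hρ : ∀ i, 0 < ρ i) (hmono : Monotone ρ) (hR : ∀ k, R k = ∑ i ∈ range k, ρ i)
    (hPoff : ∀ i j, i ≠ j → P i j = c * min 1 (ρ j / ρ i)) (hPdiag : ∀ i, P i i = 1 - ∑ j ∈ (range m).erase i, P i j)
    (hf : ∀ k i, f k i = if i < k then ρ k else if i = k then -R k else 0)
    (hβ : ∀ k, β k = 1 - c * (((m - k : ℕ) : ℝ) + R k / ρ k))
    (hP0 : ∀ i j, Pn 0 i j = if i = j then 1 else 0) (hPs : ∀ n i j, Pn (n + 1) i j = ∑ l ∈ range m, Pn n i l * P l j)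
    (n : ℕ) {i j : ℕ} (hi : i < m) (hj : j < m) :
    Pn n i j = ρ j * (1 / R m + ∑ k ∈ range m, β k ^ n * (f k i * f k j) / (ρ k * R k * R (k + 1))) := by
  induction n generalizing j with
  | zero =>
      rw [hP0, ← hubChain_complete hρ hR hf hi hj]
      congr 1; congr 1
      exact sum_congr rfl fun k _ => by rw [pow_zero, one_mul]
  | succ n ih =>
      rw [hPs]
      calc ∑ l ∈ range m, Pn n i l * P l j
          = ∑ l ∈ range m, ((1 / R m) * (ρ l * P l j) + ∑ k ∈ range m, (β k ^ n * f k i / (ρ k * R k * R (k + 1))) * (ρ l * f k l * P l j)) := by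
            refine sum_congr rfl fun l hl => ?_
            rw [ih (mem_range.mp hl), mul_add, add_mul, mul_sum, sum_mul]
            congr 1
            · ring
            · exact sum_congr rfl fun k _ => by ring
        _ = (1 / R m) * ρ j + ∑ k ∈ range m, (β k ^ n * f k i / (ρ k * R k * R (k + 1))) * (β k * ρ j * f k j) := by
            rw [sum_add_distrib, ← mul_sum, hubChain_rho_stationary hρ hPoff hPdiag hj, sum_comm]
            congr 1
            exact sum_congr rfl fun k hk => by rw [← mul_sum, hubChain_eigen_left hρ hmono hR hPoff hPdiag hf hβ (mem_range.mp hk) hj]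
        _ = ρ j * (1 / R m + ∑ k ∈ range m, β k ^ (n + 1) * (f k i * f k j) / (ρ k * R k * R (k + 1))) := by
            rw [mul_add, mul_sum]
            congr 1
            · ring
            · exact sum_congr rfl fun k _ => by rw [pow_succ]; ring

/-- The mode sum (with arbitrary mode coefficients `a_k`, e.g. `β_kⁿ` or the resolvent weights of file 3) split at the deeper rank `j ≥ i`: ranks `k < j` do not contribute,
rank `j` contributes the boundary term, ranks `k > j` contribute `a_k(1/R_k − 1/R_{k+1})`. [ours] -/
theorem hubChain_mode_sum (hρ : ∀ i, 0 < ρ i) (hR : ∀ k, R k = ∑ i ∈ range k, ρ i)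
    (hf : ∀ k i, f k i = if i < k then ρ k else if i = k then -R k else 0) (a : ℕ → ℝ) {i j : ℕ} (hij : i ≤ j) (hj : j < m) :
    ∑ k ∈ range m, a k * (f k i * f k j) / (ρ k * R k * R (k + 1))
      = a j * (f j i * f j j) / (ρ j * R j * R (j + 1)) + ∑ k ∈ Ico (j + 1) m, a k * (1 / R k - 1 / R (k + 1)) := by
  rw [hubChain_split3 hj]
  have h0 : ∑ k ∈ range j, a k * (f k i * f k j) / (ρ k * R k * R (k + 1)) = 0 := by
    refine sum_eq_zero fun k hk => ?_
    have : k < j := mem_range.mp hk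
    rw [hf k j, if_neg (by omega), if_neg (by omega)]; simp
  rw [h0, zero_add]
  congr 1
  refine sum_congr rfl fun k hk => ?_
  have hk1 : j + 1 ≤ k := (mem_Ico.mp hk).1
  have hRk : 0 < R k := by rw [hR k]; exact sum_pos (fun i _ => hρ i) ⟨0, mem_range.mpr (by omega)⟩
  have hRk1 : R (k + 1) = R k + ρ k := by rw [hR (k + 1), sum_range_succ, ← hR k]
  rw [hf k i, if_pos (by omega), hf k j, if_pos (by omega), hRk1]
  have hρk := hρ k
  field_simp
  ring

/-- **THE SMITH–TIERNEY FORM, off the diagonal:** for `i ≠ j` (ranks `< m`), `Pⁿ(i,j) = ρ_j·T_n(max(i,j))` with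
`T_n(j) = (1−β_jⁿ)/R_m + Σ_{j<k<m}(1/R_k − 1/R_{k+1})(β_kⁿ − β_jⁿ)` — a function of the deeper rank only. [ours] -/
theorem hubChain_pow_offdiag (hρ : ∀ i, 0 < ρ i) (hmono : Monotone ρ) (hR : ∀ k, R k = ∑ i ∈ range k, ρ i)
    (hPoff : ∀ i j, i ≠ j → P i j = c * min 1 (ρ j / ρ i)) (hPdiag : ∀ i, P i i = 1 - ∑ j ∈ (range m).erase i, P i j)
    (hf : ∀ k i, f k i = if i < k then ρ k else if i = k then -R k else 0)
    (hβ : ∀ k, β k = 1 - c * (((m - k : ℕ) : ℝ) + R k / ρ k))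
    (hP0 : ∀ i j, Pn 0 i j = if i = j then 1 else 0) (hPs : ∀ n i j, Pn (n + 1) i j = ∑ l ∈ range m, Pn n i l * P l j)
    (hT : ∀ n j, T n j = (1 - β j ^ n) / R m + ∑ k ∈ Ico (j + 1) m, (1 / R k - 1 / R (k + 1)) * (β k ^ n - β j ^ n))
    (n : ℕ) {i j : ℕ} (hi : i < m) (hj : j < m) (hij : i ≠ j) :
    Pn n i j = ρ j * T n (max i j) := by
  -- the `T`-form, expanded by the telescoping sum of file 1
  have hTexp : ∀ jj, jj < m → T n jj = 1 / R m - β jj ^ n / R (jj + 1) + ∑ k ∈ Ico (jj + 1) m, β k ^ n * (1 / R k - 1 / R (k + 1)) := by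
    intro jj hjj
    rw [hT]
    have e : ∑ k ∈ Ico (jj + 1) m, (1 / R k - 1 / R (k + 1)) * (β k ^ n - β jj ^ n)
        = ∑ k ∈ Ico (jj + 1) m, β k ^ n * (1 / R k - 1 / R (k + 1)) - β jj ^ n * ∑ k ∈ Ico (jj + 1) m, (1 / R k - 1 / R (k + 1)) := by
      rw [mul_sum, ← sum_sub_distrib]; exact sum_congr rfl fun k _ => by ring
    rw [e, hubChain_telescope hjj]
    ring
  rcases Nat.lt_or_gt_of_ne hij with hlt | hgt
  · -- `i < j`: deeper rank is `j`
    rw [max_eq_right hlt.le, hubChain_pow_eq hρ hmono hR hPoff hPdiag hf hβ hP0 hPs n hi hj, hubChain_mode_sum hρ hR hf (fun k => β k ^ n) hlt.le hj, hTexp j hj]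
    have hRj1 : R (j + 1) = R j + ρ j := by rw [hR (j + 1), sum_range_succ, ← hR j]
    have hRj : 0 < R j := by rw [hR j]; exact sum_pos (fun i _ => hρ i) ⟨i, mem_range.mpr hlt⟩
    rw [hf j i, if_pos hlt, hf j j, if_neg (lt_irrefl j), if_pos rfl, hRj1]
    have hρj := hρ j
    field_simp
    ring
  · -- `j < i`: deeper rank is `i`; use the symmetry of the mode sum
    rw [max_eq_left hgt.le, hubChain_pow_eq hρ hmono hR hPoff hPdiag hf hβ hP0 hPs n hi hj]
    rw [show (∑ k ∈ range m, β k ^ n * (f k i * f k j) / (ρ k * R k * R (k + 1))) = ∑ k ∈ range m, β k ^ n * (f k j * f k i) / (ρ k * R k * R (k + 1)) from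
      sum_congr rfl fun k _ => by rw [mul_comm (f k i)]]
    rw [hubChain_mode_sum hρ hR hf (fun k => β k ^ n) hgt.le hi, hTexp i hi]
    have hRi1 : R (i + 1) = R i + ρ i := by rw [hR (i + 1), sum_range_succ, ← hR i]
    have hRi : 0 < R i := by rw [hR i]; exact sum_pos (fun i _ => hρ i) ⟨j, mem_range.mpr hgt⟩
    rw [hf i j, if_pos hgt, hf i i, if_neg (lt_irrefl i), if_pos rfl, hRi1]
    have hρi := hρ i
    field_simp
    ring

/-- **THE SMITH–TIERNEY FORM, on the diagonal:** `Pⁿ(j,j) = ρ_j·T_n(j) + β_jⁿ` (`β_jⁿ` is the `n`-fold self-term; for the shallowest rank `β_0 = 1 − cm`). [ours] -/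
theorem hubChain_pow_diag (hρ : ∀ i, 0 < ρ i) (hmono : Monotone ρ) (hR : ∀ k, R k = ∑ i ∈ range k, ρ i)
    (hPoff : ∀ i j, i ≠ j → P i j = c * min 1 (ρ j / ρ i)) (hPdiag : ∀ i, P i i = 1 - ∑ j ∈ (range m).erase i, P i j)
    (hf : ∀ k i, f k i = if i < k then ρ k else if i = k then -R k else 0)
    (hβ : ∀ k, β k = 1 - c * (((m - k : ℕ) : ℝ) + R k / ρ k))
    (hP0 : ∀ i j, Pn 0 i j = if i = j then 1 else 0) (hPs : ∀ n i j, Pn (n + 1) i j = ∑ l ∈ range m, Pn n i l * P l j)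
    (hT : ∀ n j, T n j = (1 - β j ^ n) / R m + ∑ k ∈ Ico (j + 1) m, (1 / R k - 1 / R (k + 1)) * (β k ^ n - β j ^ n))
    (n : ℕ) {j : ℕ} (hj : j < m) : Pn n j j = ρ j * T n j + β j ^ n := by
  rw [hubChain_pow_eq hρ hmono hR hPoff hPdiag hf hβ hP0 hPs n hj hj, hubChain_mode_sum hρ hR hf (fun k => β k ^ n) le_rfl hj, hT]
  have e : ∑ k ∈ Ico (j + 1) m, (1 / R k - 1 / R (k + 1)) * (β k ^ n - β j ^ n)
      = ∑ k ∈ Ico (j + 1) m, β k ^ n * (1 / R k - 1 / R (k + 1)) - β j ^ n * ∑ k ∈ Ico (j + 1) m, (1 / R k - 1 / R (k + 1)) := by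
    rw [mul_sum, ← sum_sub_distrib]; exact sum_congr rfl fun k _ => by ring
  rw [e, hubChain_telescope hj]
  have hRj1 : R (j + 1) = R j + ρ j := by rw [hR (j + 1), sum_range_succ, ← hR j]
  have hR0 : 0 ≤ R j := by rw [hR j]; exact sum_nonneg fun i _ => (hρ i).le
  have hρj := hρ j
  have hRj1pos : 0 < R (j + 1) := by rw [hRj1]; linarith
  rw [hf j j, if_neg (lt_irrefl j), if_pos rfl, hRj1]
  by_cases hRj : R j = 0
  · rw [hRj]; simp; field_simp; ring
  · field_simp
    ring

/-- **Corollary (the law at a deeper target forgets the start):** for `i, i' < j < m`, `Pⁿ(i,j) = Pⁿ(i',j)` for every `n`. [ours] -/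
theorem hubChain_pow_start_indep (hρ : ∀ i, 0 < ρ i) (hmono : Monotone ρ) (hR : ∀ k, R k = ∑ i ∈ range k, ρ i)
    (hPoff : ∀ i j, i ≠ j → P i j = c * min 1 (ρ j / ρ i)) (hPdiag : ∀ i, P i i = 1 - ∑ j ∈ (range m).erase i, P i j)
    (hf : ∀ k i, f k i = if i < k then ρ k else if i = k then -R k else 0)
    (hβ : ∀ k, β k = 1 - c * (((m - k : ℕ) : ℝ) + R k / ρ k))
    (hP0 : ∀ i j, Pn 0 i j = if i = j then 1 else 0) (hPs : ∀ n i j, Pn (n + 1) i j = ∑ l ∈ range m, Pn n i l * P l j)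
    (hT : ∀ n j, T n j = (1 - β j ^ n) / R m + ∑ k ∈ Ico (j + 1) m, (1 / R k - 1 / R (k + 1)) * (β k ^ n - β j ^ n))
    (n : ℕ) {i i' j : ℕ} (hij : i < j) (hi'j : i' < j) (hj : j < m) : Pn n i j = Pn n i' j := by
  rw [hubChain_pow_offdiag hρ hmono hR hPoff hPdiag hf hβ hP0 hPs hT n (hij.trans hj) hj hij.ne,
    hubChain_pow_offdiag hρ hmono hR hPoff hPdiag hf hβ hP0 hPs hT n (hi'j.trans hj) hj hi'j.ne, max_eq_right hij.le, max_eq_right hi'j.le]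

/-- **Corollary (below the start the law is `∝ ρ`):** for targets `j, j' < i < m`, `ρ_{j'}·Pⁿ(i,j) = ρ_j·Pⁿ(i,j')` for every `n`. [ours] -/
theorem hubChain_pow_below_start (hρ : ∀ i, 0 < ρ i) (hmono : Monotone ρ) (hR : ∀ k, R k = ∑ i ∈ range k, ρ i)
    (hPoff : ∀ i j, i ≠ j → P i j = c * min 1 (ρ j / ρ i)) (hPdiag : ∀ i, P i i = 1 - ∑ j ∈ (range m).erase i, P i j)
    (hf : ∀ k i, f k i = if i < k then ρ k else if i = k then -R k else 0)
    (hβ : ∀ k, β k = 1 - c * (((m - k : ℕ) : ℝ) + R k / ρ k))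
    (hP0 : ∀ i j, Pn 0 i j = if i = j then 1 else 0) (hPs : ∀ n i j, Pn (n + 1) i j = ∑ l ∈ range m, Pn n i l * P l j)
    (hT : ∀ n j, T n j = (1 - β j ^ n) / R m + ∑ k ∈ Ico (j + 1) m, (1 / R k - 1 / R (k + 1)) * (β k ^ n - β j ^ n))
    (n : ℕ) {i j j' : ℕ} (hji : j < i) (hj'i : j' < i) (hi : i < m) : ρ j' * Pn n i j = ρ j * Pn n i j' := by
  rw [hubChain_pow_offdiag hρ hmono hR hPoff hPdiag hf hβ hP0 hPs hT n hi (hji.trans hi) hji.ne',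
    hubChain_pow_offdiag hρ hmono hR hPoff hPdiag hf hβ hP0 hPs hT n hi (hj'i.trans hi) hj'i.ne', max_eq_left hji.le, max_eq_left hj'i.le]
  ring

/-- `T_n(j) ≥ 0` for `0 < j < m` (it is `Pⁿ(0,j)/ρ_j`, a transition probability over a positive weight; `Pⁿ ≥ 0` is taken as a hypothesis on the supplied powers). [ours] -/
theorem hubChain_T_nonneg (hρ : ∀ i, 0 < ρ i) (hmono : Monotone ρ) (hR : ∀ k, R k = ∑ i ∈ range k, ρ i)
    (hPoff : ∀ i j, i ≠ j → P i j = c * min 1 (ρ j / ρ i)) (hPdiag : ∀ i, P i i = 1 - ∑ j ∈ (range m).erase i, P i j)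
    (hf : ∀ k i, f k i = if i < k then ρ k else if i = k then -R k else 0)
    (hβ : ∀ k, β k = 1 - c * (((m - k : ℕ) : ℝ) + R k / ρ k))
    (hP0 : ∀ i j, Pn 0 i j = if i = j then 1 else 0) (hPs : ∀ n i j, Pn (n + 1) i j = ∑ l ∈ range m, Pn n i l * P l j)
    (hT : ∀ n j, T n j = (1 - β j ^ n) / R m + ∑ k ∈ Ico (j + 1) m, (1 / R k - 1 / R (k + 1)) * (β k ^ n - β j ^ n))
    (hPn0 : ∀ n i j, 0 ≤ Pn n i j) (n : ℕ) {j : ℕ} (hj0 : 0 < j) (hj : j < m) : 0 ≤ T n j := by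
  have h := hubChain_pow_offdiag hρ hmono hR hPoff hPdiag hf hβ hP0 hPs hT n (hj0.trans hj) hj hj0.ne
  rw [max_eq_right hj0.le] at h
  have := hPn0 n 0 j
  rw [h] at this
  exact (mul_nonneg_iff_of_pos_left (hρ j)).mp this

end HubChainPow

end Summit.Ventures.LatticeQCDFlow.Scaling
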